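import Summits.CriticalPhenomena.PercolationContinuityZ3.Theses.PercNearOneGluing
import Literature.Probability.Percolation.PercolationEvents
import HarnessLib.Audit
import Literature.Probability.LatticeModels.ProdBernoulliIndependence
import Literature.Probability.Percolation.PercolationProofs
import Literature.Probability.Percolation.TwoClusterConditionalAssociation
import Literature.Probability.Percolation.TwoClusterConditionalAssociationProofs
import Summits.CriticalPhenomena.PercolationContinuityZ3.Theorems.PercNearOneGluingAdditiveGluingOneBond

/-! TTRL-lite variant V2513 of stmt-CriticalPhenomena-4574

(`stub_shorteningStep` of line `kn_shortening_induction`, move `small_case+small_case`: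
`n ≤ 5` and `A.card = 2`).  Kozma–Nitzan's shortening step (arXiv:2401.12397, Conjecture 6 with
the induction hypothesis displayed) for TWO relays `A = {a₀, a₁}`, `a₀` the minimiser of
`P_w(· ↔ b)` BEFORE the pair `s(v,x)` is glued: under `μ' = prodBernoulli (w[s(v,x) ↦ 1])`,
`μ'(v ↔ A) · μ'(a₀ ↔ b) ≤ μ'(v ↔ b)`.  The bound `n ≤ 5` and the induction hypothesis are not
used; the proof works on every finite weighted graph.

Proof.  Harris under `μ'` gives `μ'(v ↔ A) μ'(a₀ ↔ b) ≤ μ'(v ↔ A, a₀ ↔ b)`, and after removing the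
part on `{v ↔ b}` it remains to show `μ'(L') ≤ μ'(R')` for `L' = {v ↔ a₁, a₀ ↔ b, a₀ ↮ a₁}` and
`R' = {v ↔ a₁, a₁ ↔ b, a₀ ↮ a₁}` (the glued minimiser may have been OVERTAKEN by `a₁`, so this is
not Kozma–Nitzan's Lemma 3(i) under `μ'`).  Pull back along `ω ↦ ω ∪ {s(v,x)}`
(`goodStepEI_prodBernoulli_map_insert`: its image of `prodBernoulli w` is `μ'`): under
`μ = prodBernoulli w` the pull-backs are a sub-event of `D ∩ Q ∩ {a₀ ↔ b}` and a super-event of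
`D ∩ Q ∩ {a₁ ↔ b}`, where `D = {a₁ ↮ a₀}` and `Q = {a₁ ↔ v or a₁ ↔ x} ∩ {a₀ ↮ v} ∩ {a₀ ↮ x}` is
increasing in the open cluster of `a₁` and decreasing in the open cluster of `a₀`.  The
van den Berg–Häggström–Kahn two-cluster theorem (RSA 2006, Thm. 1.5, in the tree as
`BHK2006_twoClusterConditionalAssociation_holds`), applied on `D` to `1_Q` with `1{a₁ ↔ b}` and
with `-1{a₀ ↔ b}`, together with the pre-gluing order `μ(D, a₀ ↔ b) ≤ μ(D, a₁ ↔ b)`, gives the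
mixed-monotone Lemma-3-type comparison `μ(D ∩ Q, a₀ ↔ b) ≤ μ(D ∩ Q, a₁ ↔ b)`.
No new definitions, no named facts, standard axioms. -/

namespace Summit.CriticalPhenomena.PercolationContinuityZ3.Theorems

open MeasureTheory Set Literature.Probability.LatticeModels Literature.Probability.Percolation
open scoped Classical BigOperators

section Var2513Helpers

/-! ### Helpers: a mixed-monotone form of Kozma–Nitzan's Lemma 3 via BHK Thm. 1.5 -/

universe u

variable {V : Type u}

/-- Evaluation of the mixed up/down-closure indicator of `Q` at the pair of edge clusters
`(C_s ω, C_t ω)`: it is `1_Q ω` when `Q` is increasing in `C_s` and decreasing in `C_t`.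
[folklore] -/
theorem var2513_mixed_apply {Q : Set (BondConfig V)} {s t : V}
    (hQ : ∀ ω ω' : BondConfig V, ω ∈ Q → openEdgeCluster ω s ⊆ openEdgeCluster ω' s →
      openEdgeCluster ω' t ⊆ openEdgeCluster ω t → ω' ∈ Q)
    (ω : BondConfig V) :
    {p : Set (Sym2 V) × Set (Sym2 V) | ∃ η ∈ Q, openEdgeCluster η s ⊆ p.1 ∧
        p.2 ⊆ openEdgeCluster η t}.indicator (1 : Set (Sym2 V) × Set (Sym2 V) → ℝ)
        (openEdgeCluster ω s, openEdgeCluster ω t) = Q.indicator 1 ω := by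
  by_cases hω : ω ∈ Q
  · have h1 : (openEdgeCluster ω s, openEdgeCluster ω t) ∈ {p : Set (Sym2 V) × Set (Sym2 V) |
        ∃ η ∈ Q, openEdgeCluster η s ⊆ p.1 ∧ p.2 ⊆ openEdgeCluster η t} :=
      ⟨ω, hω, subset_rfl, subset_rfl⟩
    rw [indicator_of_mem h1, indicator_of_mem hω, Pi.one_apply, Pi.one_apply]
  · have h1 : (openEdgeCluster ω s, openEdgeCluster ω t) ∉ {p : Set (Sym2 V) × Set (Sym2 V) |
        ∃ η ∈ Q, openEdgeCluster η s ⊆ p.1 ∧ p.2 ⊆ openEdgeCluster η t} := by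
      rintro ⟨η, hη, h1, h2⟩
      exact hω (hQ η ω hη h1 h2)
    rw [indicator_of_notMem h1, indicator_of_notMem hω]

/-- The mixed closure indicator is increasing in the first (cluster of `s`) variable.
[folklore] -/
theorem var2513_mixed_mono_left (Q : Set (BondConfig V)) (s t : V) (D : Set (Sym2 V)) :
    Monotone fun C : Set (Sym2 V) =>
      {p : Set (Sym2 V) × Set (Sym2 V) | ∃ η ∈ Q, openEdgeCluster η s ⊆ p.1 ∧
        p.2 ⊆ openEdgeCluster η t}.indicator (1 : Set (Sym2 V) × Set (Sym2 V) → ℝ) (C, D) := by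
  intro C C' hCC'
  dsimp only
  by_cases h : (C, D) ∈ {p : Set (Sym2 V) × Set (Sym2 V) | ∃ η ∈ Q, openEdgeCluster η s ⊆ p.1 ∧
      p.2 ⊆ openEdgeCluster η t}
  · obtain ⟨η, hη, h1, h2⟩ := h
    have hC : (C, D) ∈ {p : Set (Sym2 V) × Set (Sym2 V) | ∃ η ∈ Q, openEdgeCluster η s ⊆ p.1 ∧
        p.2 ⊆ openEdgeCluster η t} := ⟨η, hη, h1, h2⟩
    have hC' : (C', D) ∈ {p : Set (Sym2 V) × Set (Sym2 V) | ∃ η ∈ Q, openEdgeCluster η s ⊆ p.1 ∧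
        p.2 ⊆ openEdgeCluster η t} := ⟨η, hη, h1.trans hCC', h2⟩
    rw [indicator_of_mem hC, indicator_of_mem hC', Pi.one_apply, Pi.one_apply]
  · rw [indicator_of_notMem h]
    exact indicator_nonneg (fun _ _ => zero_le_one) _

/-- The mixed closure indicator is decreasing in the second (cluster of `t`) variable.
[folklore] -/
theorem var2513_mixed_anti_right (Q : Set (BondConfig V)) (s t : V) (C : Set (Sym2 V)) :
    Antitone fun D : Set (Sym2 V) =>
      {p : Set (Sym2 V) × Set (Sym2 V) | ∃ η ∈ Q, openEdgeCluster η s ⊆ p.1 ∧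
        p.2 ⊆ openEdgeCluster η t}.indicator (1 : Set (Sym2 V) × Set (Sym2 V) → ℝ) (C, D) := by
  intro D D' hDD'
  dsimp only
  by_cases h : (C, D') ∈ {p : Set (Sym2 V) × Set (Sym2 V) | ∃ η ∈ Q, openEdgeCluster η s ⊆ p.1 ∧
      p.2 ⊆ openEdgeCluster η t}
  · obtain ⟨η, hη, h1, h2⟩ := h
    have hD' : (C, D') ∈ {p : Set (Sym2 V) × Set (Sym2 V) | ∃ η ∈ Q, openEdgeCluster η s ⊆ p.1 ∧
        p.2 ⊆ openEdgeCluster η t} := ⟨η, hη, h1, h2⟩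
    have hD : (C, D) ∈ {p : Set (Sym2 V) × Set (Sym2 V) | ∃ η ∈ Q, openEdgeCluster η s ⊆ p.1 ∧
        p.2 ⊆ openEdgeCluster η t} := ⟨η, hη, h1, hDD'.trans h2⟩
    rw [indicator_of_mem hD, indicator_of_mem hD', Pi.one_apply, Pi.one_apply]
  · rw [indicator_of_notMem h]
    exact indicator_nonneg (fun _ _ => zero_le_one) _

variable [Fintype V]

/-- **BHK (2006) Thm. 1.5 with `f = 1_Q` (increasing in `C_s`, decreasing in `C_t`) and
`g = 1{s ↔ b}`**: `μ(D ∩ Q) μ(D ∩ {s↔b}) ≤ μ(D) μ(D ∩ (Q ∩ {s↔b}))` for `D = {s ↮ t}`.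
[cite: VandenbergHaggstromKahn2005, Thm. 1.5 (p. 7)] -/
theorem var2513_bhk_incr (w : Sym2 V → unitInterval) (s t b : V) (Q : Set (BondConfig V))
    (hQ : ∀ ω ω' : BondConfig V, ω ∈ Q → openEdgeCluster ω s ⊆ openEdgeCluster ω' s →
      openEdgeCluster ω' t ⊆ openEdgeCluster ω t → ω' ∈ Q) (hst : s ≠ t) :
    (prodBernoulli w).real ((openConn s t)ᶜ ∩ Q) *
        (prodBernoulli w).real ((openConn s t)ᶜ ∩ openConn s b) ≤
      (prodBernoulli w).real (openConn s t)ᶜ *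
        (prodBernoulli w).real ((openConn s t)ᶜ ∩ (Q ∩ openConn s b)) := by
  have key := BHK2006_twoClusterConditionalAssociation_holds V w s t
    (fun C D => {p : Set (Sym2 V) × Set (Sym2 V) | ∃ η ∈ Q, openEdgeCluster η s ⊆ p.1 ∧
        p.2 ⊆ openEdgeCluster η t}.indicator (1 : Set (Sym2 V) × Set (Sym2 V) → ℝ) (C, D))
    (fun C _ => connIndicatorFn s b C)
    (fun D => var2513_mixed_mono_left Q s t D) (fun C => var2513_mixed_anti_right Q s t C)
    (fun _ => monotone_connIndicatorFn s b) (fun _ => antitone_const) hst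
  have hD : {ω : BondConfig V | ¬ (openGraph ω).Reachable s t} = (openConn s t)ᶜ := rfl
  have hma : MeasurableSet (openConn s b : Set (BondConfig V)) := measurableSet_openConn_holds s b
  have hmQ : MeasurableSet Q := MeasurableSet.of_discrete
  simp only [connIndicatorFn_openEdgeCluster, var2513_mixed_apply hQ, hD] at key
  rw [show (fun ω : BondConfig V => Q.indicator (1 : BondConfig V → ℝ) ω *
        (openConn s b).indicator 1 ω) = (Q ∩ openConn s b).indicator 1 from
      funext fun ω => (congrFun (Set.inter_indicator_one (s := Q)
        (t := openConn s b) (M₀ := ℝ)) ω).symm] at key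
  rw [setIntegral_indicator (hmQ.inter hma), setIntegral_indicator hmQ, setIntegral_indicator hma]
    at key
  simpa only [Pi.one_apply, setIntegral_const, smul_eq_mul, mul_one] using key

/-- **BHK (2006) Thm. 1.5 with `f = 1_Q` (increasing in `C_s`, decreasing in `C_t`) and
`g = -1{t ↔ b}`**: `μ(D) μ(D ∩ (Q ∩ {t↔b})) ≤ μ(D ∩ Q) μ(D ∩ {t↔b})` for `D = {s ↮ t}`.
[cite: VandenbergHaggstromKahn2005, Thm. 1.5 (p. 7)] -/
theorem var2513_bhk_decr (w : Sym2 V → unitInterval) (s t b : V) (Q : Set (BondConfig V))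
    (hQ : ∀ ω ω' : BondConfig V, ω ∈ Q → openEdgeCluster ω s ⊆ openEdgeCluster ω' s →
      openEdgeCluster ω' t ⊆ openEdgeCluster ω t → ω' ∈ Q) (hst : s ≠ t) :
    (prodBernoulli w).real (openConn s t)ᶜ *
        (prodBernoulli w).real ((openConn s t)ᶜ ∩ (Q ∩ openConn t b)) ≤
      (prodBernoulli w).real ((openConn s t)ᶜ ∩ Q) *
        (prodBernoulli w).real ((openConn s t)ᶜ ∩ openConn t b) := by
  have key := BHK2006_twoClusterConditionalAssociation_holds V w s t
    (fun C D => {p : Set (Sym2 V) × Set (Sym2 V) | ∃ η ∈ Q, openEdgeCluster η s ⊆ p.1 ∧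
        p.2 ⊆ openEdgeCluster η t}.indicator (1 : Set (Sym2 V) × Set (Sym2 V) → ℝ) (C, D))
    (fun _ D => -connIndicatorFn t b D)
    (fun D => var2513_mixed_mono_left Q s t D) (fun C => var2513_mixed_anti_right Q s t C)
    (fun _ => monotone_const) (fun _ _ _ hDD' => neg_le_neg (monotone_connIndicatorFn t b hDD'))
    hst
  have hD : {ω : BondConfig V | ¬ (openGraph ω).Reachable s t} = (openConn s t)ᶜ := rfl
  have hma : MeasurableSet (openConn t b : Set (BondConfig V)) := measurableSet_openConn_holds t b
  have hmQ : MeasurableSet Q := MeasurableSet.of_discrete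
  simp only [connIndicatorFn_openEdgeCluster, var2513_mixed_apply hQ, hD, mul_neg,
    integral_neg] at key
  rw [show (fun ω : BondConfig V => Q.indicator (1 : BondConfig V → ℝ) ω *
        (openConn t b).indicator 1 ω) = (Q ∩ openConn t b).indicator 1 from
      funext fun ω => (congrFun (Set.inter_indicator_one (s := Q)
        (t := openConn t b) (M₀ := ℝ)) ω).symm] at key
  rw [setIntegral_indicator (hmQ.inter hma), setIntegral_indicator hmQ, setIntegral_indicator hma]
    at key
  simp only [Pi.one_apply, setIntegral_const, smul_eq_mul, mul_one] at key
  linarith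

omit [Fintype V] in
/-- Open paths after opening one pair: if `a ↔ b` in `ω ∪ {s(u,u')}` then already in `ω`
either `a ↔ b`, or `a ↔ u`, or `a ↔ u'` (cut the path at its first use of the new pair).
[folklore] -/
theorem var2513_reachable_insert {ω : BondConfig V} {u u' a b : V}
    (h : (openGraph (insert s(u, u') ω)).Reachable a b) :
    (openGraph ω).Reachable a b ∨ (openGraph ω).Reachable a u ∨ (openGraph ω).Reachable a u' := by
  obtain ⟨p⟩ := h
  induction p with
  | nil => exact Or.inl (SimpleGraph.Reachable.refl _)
  | cons hadj p ih =>
    rename_i a' c b'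
    obtain ⟨hmem, hne⟩ := (openGraph_adj _ a' c).1 hadj
    rcases Set.mem_insert_iff.1 hmem with heq | hω
    · rcases Sym2.eq_iff.1 heq with ⟨rfl, -⟩ | ⟨rfl, -⟩
      · exact Or.inr (Or.inl (SimpleGraph.Reachable.refl _))
      · exact Or.inr (Or.inr (SimpleGraph.Reachable.refl _))
    · have hac : (openGraph ω).Reachable a' c :=
        SimpleGraph.Adj.reachable ((openGraph_adj ω a' c).2 ⟨hω, hne⟩)
      rcases ih with h | h | h
      · exact Or.inl (hac.trans h)
      · exact Or.inr (Or.inl (hac.trans h))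
      · exact Or.inr (Or.inr (hac.trans h))

omit [Fintype V] in
/-- Reachability from `s` is transported along an inclusion of open edge clusters `C_s`.
[folklore] -/
theorem var2513_reachable_of_openEdgeCluster_subset {ω ω' : BondConfig V} {s a : V}
    (hsub : openEdgeCluster ω s ⊆ openEdgeCluster ω' s) (h : (openGraph ω).Reachable s a) :
    (openGraph ω').Reachable s a := by
  rw [reachable_iff_exists_mem_openEdgeCluster] at h ⊢
  exact h.imp id fun ⟨e, he, hae⟩ => ⟨e, hsub he, hae⟩

/-- On `D = {a₁ ↮ a₀}` the order `μ(a₀ ↔ b) ≤ μ(a₁ ↔ b)` persists: off `D` the two events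
coincide. [cite: KozmaNitzan2024, proof of Lemma 3 (p. 6)] -/
theorem var2513_order_on_D (w : Sym2 V → unitInterval) (a₀ a₁ b : V)
    (h : (prodBernoulli w).real (openConn a₀ b) ≤ (prodBernoulli w).real (openConn a₁ b)) :
    (prodBernoulli w).real ((openConn a₁ a₀)ᶜ ∩ openConn a₀ b) ≤
      (prodBernoulli w).real ((openConn a₁ a₀)ᶜ ∩ openConn a₁ b) := by
  have hDm : MeasurableSet ((openConn a₁ a₀)ᶜ : Set (BondConfig V)) := MeasurableSet.of_discrete
  have hs1 := measureReal_inter_add_sdiff (μ := prodBernoulli w) (s := openConn a₀ b) hDm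
  have hs2 := measureReal_inter_add_sdiff (μ := prodBernoulli w) (s := openConn a₁ b) hDm
  have he : (openConn a₀ b : Set (BondConfig V)) \ (openConn a₁ a₀)ᶜ =
      openConn a₁ b \ (openConn a₁ a₀)ᶜ := by
    ext ω
    simp only [Set.mem_sdiff, Set.mem_compl_iff, not_not]
    constructor
    · rintro ⟨h1, h2⟩
      exact ⟨SimpleGraph.Reachable.trans h2 h1, h2⟩
    · rintro ⟨h1, h2⟩
      exact ⟨SimpleGraph.Reachable.trans (SimpleGraph.Reachable.symm h2) h1, h2⟩
  rw [he] at hs1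
  rw [Set.inter_comm] at hs1 hs2
  linarith

end Var2513Helpers

/-- TTRL-lite variant V2513 of `stub_shorteningStep` (stmt-CriticalPhenomena-4574, Kozma–Nitzan
Conjecture 6 with the induction hypothesis displayed), case `A.card = 2` (and `n ≤ 5`, unused):
`μ'(⋃ a ∈ A, v ↔ a) · μ'(a₀ ↔ b) ≤ μ'(v ↔ b)` for the glued measure
`μ' = prodBernoulli (w[s(v,x) ↦ 1])`, where `a₀` minimises `P_w(· ↔ b)` on `A = {a₀, a₁}` BEFORE
the gluing.  Proof (no use of the induction hypothesis): Harris under `μ'` reduces to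
`μ'(v ↔ A, a₀ ↔ b) ≤ μ'(v ↔ b)`; removing the common part `{v ↔ b}` it remains to compare
`L' = {v ↔ a₁, a₀ ↔ b, a₀ ↮ a₁}` with `R' = {v ↔ a₁ ↔ b, a₀ ↮ a₁}` under `μ'`.  Pulling back along
`ω ↦ ω ∪ {s(v,x)}` (`goodStepEI_prodBernoulli_map_insert`) these become, under `μ = prodBernoulli w`,
sub- and super-events of `D ∩ Q ∩ {a₀ ↔ b}` and `D ∩ Q ∩ {a₁ ↔ b}` with `D = {a₁ ↮ a₀}` and
`Q = {a₁ ↔ v or x} ∩ {a₀ ↮ v} ∩ {a₀ ↮ x}`, an event increasing in the cluster of `a₁` and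
decreasing in the cluster of `a₀`; van den Berg–Häggström–Kahn's two-cluster theorem (Thm. 1.5,
used twice: with `1{a₁ ↔ b}` and with `-1{a₀ ↔ b}`) and the pre-gluing order
`μ(D, a₀ ↔ b) ≤ μ(D, a₁ ↔ b)` give `μ(D ∩ Q, a₀ ↔ b) ≤ μ(D ∩ Q, a₁ ↔ b)` (a mixed-monotone form of
Kozma–Nitzan's Lemma 3). -/
theorem stub_shorteningStep_var2513 : ∀ (n : ℕ) (w : Sym2 (Fin n) → unitInterval) (A : Finset (Fin n)) (b v x a₀ : Fin n), n ≤ 5 → A.card = 2 → v ∉ A → v ≠ x → w s(v, x) = 0 → a₀ ∈ A → (∀ a ∈ A, (prodBernoulli w).real (openConn a₀ b) ≤ (prodBernoulli w).real (openConn a b)) → (∀ w' : Sym2 (Fin n) → unitInterval, (∀ e, w e = 0 → w' e = 0) → ∀ (A' : Finset (Fin n)) (o' b' : Fin n) (t : ℝ), (∀ a ∈ A', t ≤ (prodBernoulli w').real (openConn a b')) → (prodBernoulli w').real (⋃ a ∈ A', openConn o' a) * t ≤ (prodBernoulli w').real (openConn o' b')) → (prodBernoulli (Function.update w s(v, x)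 1)).real (⋃ a ∈ A, openConn v a) * (prodBernoulli (Function.update w s(v, x) 1)).real (openConn a₀ b) ≤ (prodBernoulli (Function.update w s(v, x) 1)).real (openConn v b) := by
  intro n w A b v x a₀ _hn hcard hvA hvx _hw0 ha₀ hmin _hIH
  -- the second relay `a₁`, `A = {a₀, a₁}`
  obtain ⟨a₁, ha₁0, hA⟩ : ∃ a₁, a₁ ≠ a₀ ∧ A = {a₀, a₁} := by
    obtain ⟨p, q, hpq, hApq⟩ := Finset.card_eq_two.1 hcard
    have ha₀' : a₀ = p ∨ a₀ = q := by
      rw [hApq, Finset.mem_insert, Finset.mem_singleton] at ha₀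
      exact ha₀
    rcases ha₀' with h | h
    · refine ⟨q, fun hq => hpq ?_, by rw [h]; exact hApq⟩
      rw [hq, h]
    · refine ⟨p, fun hp => hpq (hp.trans h), by rw [h, Finset.pair_comm]; exact hApq⟩
  have ha₁A : a₁ ∈ A := by rw [hA]; simp
  have ha₀v : a₀ ≠ v := fun h => hvA (h ▸ (hA ▸ by simp))
  have ha₁v : a₁ ≠ v := fun h => hvA (h ▸ ha₁A)
  -- the pre-gluing order of the two relays
  have hord0 : (prodBernoulli w).real (openConn a₀ b) ≤ (prodBernoulli w).real (openConn a₁ b) :=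
    hmin a₁ ha₁A
  -- the union over `A`
  have hU : (⋃ a ∈ A, openConn v a : Set (BondConfig (Fin n))) = openConn v a₀ ∪ openConn v a₁ := by
    rw [hA, Finset.set_biUnion_insert, Finset.set_biUnion_singleton]
  rw [hU]
  -- notation
  set μ' := prodBernoulli (Function.update w s(v, x) 1) with hμ'
  set μ := prodBernoulli w with hμ
  set U : Set (BondConfig (Fin n)) := openConn v a₀ ∪ openConn v a₁ with hUdef
  set E₁ : Set (BondConfig (Fin n)) := U ∩ openConn a₀ b with hE₁
  set L' : Set (BondConfig (Fin n)) := openConn v a₁ ∩ (openConn a₀ b ∩ (openConn a₀ a₁)ᶜ)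
    with hL'
  set R' : Set (BondConfig (Fin n)) := openConn v a₁ ∩ (openConn a₁ b ∩ (openConn a₀ a₁)ᶜ)
    with hR'
  -- Step 1: Harris under `μ'`
  have h1 : μ'.real U * μ'.real (openConn a₀ b) ≤ μ'.real E₁ :=
    prodBernoulli_harris _ ((isUpperSet_openConn v a₀).union (isUpperSet_openConn v a₁))
      (isUpperSet_openConn a₀ b) MeasurableSet.of_discrete MeasurableSet.of_discrete
  -- Step 2: split `E₁` along `{v ↔ b}`
  have hsplit : μ'.real (E₁ ∩ openConn v b) + μ'.real (E₁ \ openConn v b) = μ'.real E₁ :=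
    measureReal_inter_add_sdiff MeasurableSet.of_discrete
  have hsubL : E₁ \ openConn v b ⊆ L' := by
    rintro ω ⟨⟨hUω, ha₀b⟩, hnvb⟩
    have hva₁ : (openGraph ω).Reachable v a₁ := by
      rcases hUω with h | h
      · exact absurd (SimpleGraph.Reachable.trans h ha₀b) hnvb
      · exact h
    refine ⟨hva₁, ha₀b, fun h01 => hnvb ?_⟩
    exact hva₁.trans ((SimpleGraph.Reachable.symm h01).trans ha₀b)
  have hsubR : R' ⊆ openConn v b \ E₁ := by
    rintro ω ⟨hva₁, ha₁b, hn01⟩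
    refine ⟨hva₁.trans ha₁b, ?_⟩
    rintro ⟨-, ha₀b⟩
    exact hn01 (SimpleGraph.Reachable.trans ha₀b (SimpleGraph.Reachable.symm ha₁b))
  have hdisj : Disjoint (E₁ ∩ openConn v b) R' := by
    rw [Set.disjoint_left]
    rintro ω ⟨hE, -⟩ hR
    exact (hsubR hR).2 hE
  have hunion : μ'.real (E₁ ∩ openConn v b ∪ R') = μ'.real (E₁ ∩ openConn v b) + μ'.real R' :=
    measureReal_union hdisj MeasurableSet.of_discrete
  have hle_vb : μ'.real (E₁ ∩ openConn v b ∪ R') ≤ μ'.real (openConn v b) :=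
    measureReal_mono (Set.union_subset Set.inter_subset_right fun ω hω => (hsubR hω).1)
  have hLmono : μ'.real (E₁ \ openConn v b) ≤ μ'.real L' := measureReal_mono hsubL
  -- Step 3: `μ'(L') ≤ μ'(R')` by pulling back to `μ` and BHK
  have key : μ'.real L' ≤ μ'.real R' := by
    -- transfer along `ω ↦ insert s(v,x) ω`
    have hmi : Measurable fun ω : BondConfig (Fin n) => insert s(v, x) ω := by
      refine measurable_set_iff.2 fun i => ?_
      simp only [Set.mem_insert_iff]
      exact measurable_const.or (measurable_set_mem i)
    have htr : ∀ S : Set (BondConfig (Fin n)),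
        μ'.real S = μ.real ((fun ω : BondConfig (Fin n) => insert s(v, x) ω) ⁻¹' S) := by
      intro S
      rw [hμ', ← goodStepEI_prodBernoulli_map_insert w s(v, x),
        map_measureReal_apply hmi MeasurableSet.of_discrete]
    rw [htr L', htr R']
    -- the unglued events
    set D : Set (BondConfig (Fin n)) := (openConn a₁ a₀)ᶜ with hD
    set Q : Set (BondConfig (Fin n)) :=
      (openConn a₁ v ∪ openConn a₁ x) ∩ ((openConn a₀ v)ᶜ ∩ (openConn a₀ x)ᶜ) with hQ
    have hsub : ∀ ω : BondConfig (Fin n), ω ⊆ insert s(v, x) ω := fun ω => Set.subset_insert _ _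
    have hadj : ∀ ω : BondConfig (Fin n), (openGraph (insert s(v, x) ω)).Reachable x v := fun ω =>
      (SimpleGraph.Adj.reachable ((openGraph_adj _ v x).2 ⟨Set.mem_insert _ _, hvx⟩)).symm
    have hL : (fun ω : BondConfig (Fin n) => insert s(v, x) ω) ⁻¹' L' ⊆ D ∩ (Q ∩ openConn a₀ b) := by
      intro ω hω
      simp only [Set.mem_preimage] at hω
      obtain ⟨hva₁', ha₀b', hna'⟩ := hω
      have hn0v : ¬ (openGraph ω).Reachable a₀ v := fun h =>
        hna' ((h.mono (openGraph_mono (hsub ω))).trans hva₁')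
      have hn0x : ¬ (openGraph ω).Reachable a₀ x := fun h =>
        hna' (((h.mono (openGraph_mono (hsub ω))).trans (hadj ω)).trans hva₁')
      refine ⟨?_, ⟨?_, hn0v, hn0x⟩, ?_⟩
      · intro h10
        exact hna' (SimpleGraph.Reachable.symm (h10.mono (openGraph_mono (hsub ω))))
      · rcases var2513_reachable_insert (SimpleGraph.Reachable.symm hva₁') with h | h | h
        · exact Or.inl h
        · exact Or.inl h
        · exact Or.inr h
      · rcases var2513_reachable_insert ha₀b' with h | h | h
        · exact h
        · exact absurd h hn0v
        · exact absurd h hn0x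
    have hR : D ∩ (Q ∩ openConn a₁ b) ⊆ (fun ω : BondConfig (Fin n) => insert s(v, x) ω) ⁻¹' R' := by
      rintro ω ⟨hD10, ⟨hQ1, hn0v, hn0x⟩, ha₁b⟩
      simp only [Set.mem_preimage]
      refine ⟨?_, ha₁b.mono (openGraph_mono (hsub ω)), ?_⟩
      · rcases hQ1 with h | h
        · exact SimpleGraph.Reachable.symm (h.mono (openGraph_mono (hsub ω)))
        · exact ((h.mono (openGraph_mono (hsub ω))).trans (hadj ω)).symm
      · intro h01
        rcases var2513_reachable_insert h01 with h | h | h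
        · exact hD10 (SimpleGraph.Reachable.symm h)
        · exact hn0v h
        · exact hn0x h
    -- `Q` is increasing in the cluster of `a₁` and decreasing in the cluster of `a₀`
    have hQmix : ∀ ω ω' : BondConfig (Fin n), ω ∈ Q →
        openEdgeCluster ω a₁ ⊆ openEdgeCluster ω' a₁ →
        openEdgeCluster ω' a₀ ⊆ openEdgeCluster ω a₀ → ω' ∈ Q := by
      rintro ω ω' ⟨hQ1, hn0v, hn0x⟩ h1 h0
      refine ⟨?_, fun h => hn0v (var2513_reachable_of_openEdgeCluster_subset h0 h),
        fun h => hn0x (var2513_reachable_of_openEdgeCluster_subset h0 h)⟩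
      rcases hQ1 with h | h
      · exact Or.inl (var2513_reachable_of_openEdgeCluster_subset h1 h)
      · exact Or.inr (var2513_reachable_of_openEdgeCluster_subset h1 h)
    -- BHK twice, and the pre-gluing order on `D`
    have hBL := var2513_bhk_decr w a₁ a₀ b Q hQmix ha₁0
    have hBR := var2513_bhk_incr w a₁ a₀ b Q hQmix ha₁0
    have hordD := var2513_order_on_D w a₀ a₁ b hord0
    have hchain : μ.real (D ∩ (Q ∩ openConn a₀ b)) ≤ μ.real (D ∩ (Q ∩ openConn a₁ b)) := by
      rcases eq_or_lt_of_le (measureReal_nonneg : 0 ≤ μ.real D) with hD0 | hDpos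
      · have h0 : μ.real (D ∩ (Q ∩ openConn a₀ b)) = 0 :=
          measureReal_mono_null Set.inter_subset_left hD0.symm
        rw [h0]
        exact measureReal_nonneg
      · refine le_of_mul_le_mul_left ?_ hDpos
        calc μ.real D * μ.real (D ∩ (Q ∩ openConn a₀ b))
            ≤ μ.real (D ∩ Q) * μ.real (D ∩ openConn a₀ b) := hBL
          _ ≤ μ.real (D ∩ Q) * μ.real (D ∩ openConn a₁ b) :=
            mul_le_mul_of_nonneg_left hordD measureReal_nonneg
          _ ≤ μ.real D * μ.real (D ∩ (Q ∩ openConn a₁ b)) := hBR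
    exact (measureReal_mono hL).trans (hchain.trans (measureReal_mono hR))
  -- Step 4: combine
  linarith [hsplit, hunion, hle_vb, hLmono, key, h1]

end Summit.CriticalPhenomena.PercolationContinuityZ3.Theorems
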